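import Summits.BirchSwinnertonDyer.BirchSwinnertonDyer.Theorems.ResidualThetaTransportAtTwoResidualSignedLambdaLowerCMAtTwoFourTermOneSided
import Summits.BirchSwinnertonDyer.BirchSwinnertonDyer.Theorems.ResidualThetaTransportAtTwoLambdaLowerBoundOWeierstrass

/-!
# Sketch (stub-ideation k1 g25, «weaken / strengthen», `stub_cmLambdaLower`, crux stmt-BirchSwinnertonDyer-26074)
# THE MULTIPLIER'S TYPE: audit of the hold-opening bytes `KZgHold.lean` 464388a381f0bcfe (pen bsd-wall-p2 g19, 10:32Z)

BSD is NOT proved by anything here; RSL_g (stmt-22608), (R≥)ᵖ (stmt-26074) and the hold KZ_g (stmt-24105) stay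
OPEN / HOLD.  Nothing about any curve or form is asserted: THEOREMS ONLY (no `def`, no `instance`, no notation, no
`sorry`), pure commutative / linear algebra over a commutative ring `R`, resp. over `Λ = A⟦X⟧` (`A` a DVR,
`F = Frac A`) in the λ-currency `dim_F (F ⊗_A ·)` of the companion Theorems files (`lamO S X` unfolds to it with
`A := padicCoeffIntegers S`).

WHAT (the event).  The pen's child A `KZgDraft.KatoZetaValuedClassCMAtTwo` types the values multiplier as an
IWASAWA-ALGEBRA element `μt : Λ_𝒪` (values `q · μt(ψ(5) − 1) · L_MT(ψ)`), motivated by Kato's §15 classes `z^{(𝔞)}`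
(`μ_𝔞 = N𝔞 − σ_𝔞`, `λ(μ_𝔞) ≥ 1` at `p = 2`), and child B carries the matching slack `+ λ_𝒪(Λ_𝒪/(μt))` (critic S133:
accepted).  The delivered (i)-half value chain, however, consumes 𝒪-CONSTANT multipliers only (S127 K-α socket
`isCongrModOmegaO_mazurTateElementK_of_forall_character (μ : 𝒪) …`, k2-g20 relay `hERL_of_mazurTateValues … (μ ν : 𝒪)
(w : Λ_𝒪) … IsUnit w …`), i.e. exactly the multipliers with `λ(μt) = 0` — for which the slack VANISHES (§2, K1).
The card states the two coherent resolutions (R1: constant multiplier in A — print by Kato Thm 12.5 (1) `z_γ ∈ 𝐇¹(V) =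
𝐇¹(T) ⊗ ℚ`, denominators cleared — and then B needs no slack; R2: keep `μt ∈ Λ_𝒪` and generalise socket + relay to a
Λ-multiplier, B keeps the slack) and certifies here the algebra both rest on:

§1 K3  rank-one injectivity `injective_of_apply_ne_zero` (an `R`-module that embeds in `R` maps injectively into any
       torsion-free module as soon as the map is nonzero) and K3′ commensurability of two valued classes
       `smul_eq_smul_of_apply_eq_mul` (`f zᵢ = aᵢ·L ⇒ a₂•z₁ = a₁•z₂`);
§2 K1  constants are λ-invisible (`finrank_baseChange_eq_zero_of_smul_eq_zero`, and the slack of a constant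
       multiplier `λ(Λ/(C c)) = 0`); K2 the slack is additive `λ(Λ/(r·μ)) = λ(Λ/(μ)) + λ(Λ/(r))` (one-line instance
       of the LANDED `CharIdealLambda.finrank_baseChange_quotient_span_smul_eq_add`); K5 the slack-corrected zeta
       quotient `λ(H/Λz) − λ(Λ/(a))` is an INVARIANT of the valued line (`f z = a·L`): the pen's slack is exactly the
       weakest coherent one, and it is void precisely on the constant-multiplier classes the sockets consume;
§3 K4  the values-level shift `Σ_b ψ(b)⁻¹ • F(b·b₀) = ψ(b₀) • Σ_b ψ(b)⁻¹ • F(b)` (why `z ↦ (γ−1)•z`, `μt ↦ T·μt` stays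
       «valued»: Λ-valued multipliers of every λ occur as soon as one does).
-/

set_option autoImplicit false
set_option linter.dupNamespace false

noncomputable section

open scoped TensorProduct

namespace Summit.BirchSwinnertonDyer.BirchSwinnertonDyer.Cruxes.ResidualThetaCountLowerPureAtTwo.SideaK1G25

open Summit.BirchSwinnertonDyer.BirchSwinnertonDyer.Theorems

/-! ## §1 Rank one: a nonzero map out of a line is injective; valued classes are commensurable -/

section RankOne

variable {R : Type*} [CommRing R] {M N : Type*} [AddCommGroup M] [Module R M] [AddCommGroup N] [Module R N]

/-- **K3 (rank-one injectivity).** If `M` embeds `R`-linearly into `R` (the tree's EMB shape for Kato's rank-one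
`𝐇¹_Γ`: `Module.exists_injective_linearMap_of_rank_le_one`) and `N` is torsion-free, every `R`-linear `f : M → N`
with ONE nonzero value is injective.  (Use: `𝒸 = col^{⊕n} ∘ locd₂` restricted to `𝐇¹_Γ(T_ρ)` is injective as soon as
one valued class has a nonzero value.) [folklore] -/
theorem injective_of_apply_ne_zero [NoZeroSMulDivisors R N] (e : M →ₗ[R] R) (he : Function.Injective e)
    (f : M →ₗ[R] N) {y : M} (hy : f y ≠ 0) : Function.Injective f := by
  intro x₁ x₂ hx
  rw [← sub_eq_zero]
  have hfx : f (x₁ - x₂) = 0 := by rw [map_sub, hx, sub_self]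
  have key : e y • (x₁ - x₂) = e (x₁ - x₂) • y :=
    he (by rw [map_smul, map_smul, smul_eq_mul, smul_eq_mul, mul_comm])
  have h2 : e (x₁ - x₂) • f y = 0 := by rw [← LinearMap.map_smul, ← key, LinearMap.map_smul, hfx, smul_zero]
  have hex : e (x₁ - x₂) = 0 := (eq_zero_or_eq_zero_of_smul_eq_zero h2).resolve_right hy
  exact he (by rw [hex, map_zero])

/-- **K3′ (commensurability of valued classes).** Two classes whose values are multiples `a₁·L`, `a₂·L` of one
`L` under an injective `R`-linear functional are `R`-commensurable: `a₂ • z₁ = a₁ • z₂`.  (Use: any two tuples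
satisfying child A's value clauses, multipliers `q₁μt₁`, `q₂μt₂`, give `(q₂μt₂)•z₁ = (q₁μt₁)•z₂` in `𝐇¹_Γ(T_ρ)`.)
[folklore] -/
theorem smul_eq_smul_of_apply_eq_mul (f : M →ₗ[R] R) (hf : Function.Injective f) {z₁ z₂ : M} {a₁ a₂ L : R}
    (h₁ : f z₁ = a₁ * L) (h₂ : f z₂ = a₂ * L) : a₂ • z₁ = a₁ • z₂ :=
  hf (by rw [map_smul, map_smul, smul_eq_mul, smul_eq_mul, h₁, h₂]; ring)

/-- Torsion-freeness of a class with a nonzero value (bridge to the `hz` hypothesis of the landed λ-bookkeeping). -/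
theorem smul_eq_zero_imp_of_apply_ne_zero [IsDomain R] (f : M →ₗ[R] R) {z : M} (hz : f z ≠ 0) :
    ∀ a : R, a • z = 0 → a = 0 := by
  intro a ha
  have h : a * f z = 0 := by rw [← smul_eq_mul, ← map_smul, ha, map_zero]
  exact (mul_eq_zero.mp h).resolve_right hz

end RankOne

/-! ## §2 λ-bookkeeping of the multiplier slack `λ(Λ/(μt))` -/

section Slack

universe u w

variable {A : Type u} [CommRing A] [IsDomain A] [IsDiscreteValuationRing A]
  [IsAdicComplete (IsLocalRing.maximalIdeal A) A]
variable (F : Type w) [Field F] [Algebra A F] [IsFractionRing A F]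

omit [IsDomain A] [IsDiscreteValuationRing A] [IsAdicComplete (IsLocalRing.maximalIdeal A) A] in
/-- **K1 (constants are λ-invisible).** A module killed by a nonzero constant has `dim_F (F ⊗_A M) = 0`. [folklore] -/
theorem finrank_baseChange_eq_zero_of_smul_eq_zero (c : A) (hc : c ≠ 0) (M : Type*) [AddCommGroup M]
    [Module A M] (h : ∀ m : M, c • m = 0) : Module.finrank F (F ⊗[A] M) = 0 := by
  have hcF : algebraMap A F c ≠ 0 := fun h0 => hc (IsFractionRing.injective A F (by rw [h0, map_zero]))
  have hz : ∀ z : F ⊗[A] M, z = 0 := by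
    intro z
    induction z using TensorProduct.induction_on with
    | zero => rfl
    | tmul f m =>
        calc f ⊗ₜ[A] m = ((f * (algebraMap A F c)⁻¹) * algebraMap A F c) ⊗ₜ[A] m := by
              rw [inv_mul_cancel_right₀ hcF]
          _ = (c • (f * (algebraMap A F c)⁻¹)) ⊗ₜ[A] m := by
              rw [Algebra.smul_def, mul_comm (algebraMap A F c)]
          _ = (f * (algebraMap A F c)⁻¹) ⊗ₜ[A] (c • m) := TensorProduct.smul_tmul _ _ _
          _ = 0 := by rw [h, TensorProduct.tmul_zero]
    | add x y hx hy => rw [hx, hy, add_zero]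
  haveI : Subsingleton (F ⊗[A] M) := ⟨fun x y => by rw [hz x, hz y]⟩
  exact Module.finrank_zero_of_subsingleton

omit [IsDomain A] [IsDiscreteValuationRing A] [IsAdicComplete (IsLocalRing.maximalIdeal A) A] in
/-- **K1′ (the slack of a constant multiplier is zero):** `dim_F (F ⊗_A Λ/(C c)) = 0` for `c ∈ A ∖ 0` — with
`A := 𝒪`, `Λ := Λ_𝒪` this is `lamO (Λ_𝒪 ⧸ Ideal.span {C μ}) = 0`: under resolution R1 (constant multiplier) child B's
slack term vanishes and S132 α's slack-free composite is the right text. [folklore] -/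
theorem finrank_baseChange_quot_span_C_eq_zero (c : A) (hc : c ≠ 0) :
    Module.finrank F (F ⊗[A] (PowerSeries A ⧸ Ideal.span {(PowerSeries.C c : PowerSeries A)})) = 0 := by
  refine finrank_baseChange_eq_zero_of_smul_eq_zero F c hc _ fun m => ?_
  obtain ⟨x, rfl⟩ := Ideal.Quotient.mk_surjective m
  rw [← IsScalarTower.algebraMap_smul (PowerSeries A) c, ← PowerSeries.C_eq_algebraMap,
    ← Ideal.Quotient.mk_eq_mk, ← Submodule.Quotient.mk_smul, Ideal.Quotient.mk_eq_mk,
    Ideal.Quotient.eq_zero_iff_mem, smul_eq_mul]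
  exact Ideal.mul_mem_right _ _ (Ideal.mem_span_singleton_self _)

/-- **K2 (the slack is additive):** `λ(Λ/(r·μ)) = λ(Λ/(μ)) + λ(Λ/(r))` for `r, μ ∈ Λ ∖ 0` — the LANDED
`CharIdealLambda.finrank_baseChange_quotient_span_smul_eq_add` (file `…FourTermOneSided`) at `H := Λ`, `z := μ`,
`D := r` (`Submodule.span Λ {x}` is `Ideal.span {x}` unfolded).  Use: the (ii_λ) clause of child B is invariant under
`(z, μt) ↦ (r•z, r·μt)`. [cite: Washington1997, §13.2 (λ is additive)] -/
theorem finrank_baseChange_quot_span_mul_eq_add (r μ : PowerSeries A) (hr : r ≠ 0) (hμ : μ ≠ 0) :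
    Module.finrank F (F ⊗[A] (PowerSeries A ⧸ Submodule.span (PowerSeries A) {r • μ})) =
      Module.finrank F (F ⊗[A] (PowerSeries A ⧸ Submodule.span (PowerSeries A) {μ})) +
        Module.finrank F (F ⊗[A] (PowerSeries A ⧸ Ideal.span {r})) := by
  have hz : ∀ a : PowerSeries A, a • μ = 0 → a = 0 := fun a ha =>
    (mul_eq_zero.mp ((smul_eq_mul a μ).symm.trans ha)).resolve_right hμ
  have htors : Module.IsTorsion (PowerSeries A) (PowerSeries A ⧸ Submodule.span (PowerSeries A) {μ}) := by
    intro x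
    refine ⟨⟨μ, mem_nonZeroDivisors_of_ne_zero hμ⟩, ?_⟩
    obtain ⟨y, rfl⟩ := Submodule.mkQ_surjective (Submodule.span (PowerSeries A) {μ}) x
    rw [Submonoid.mk_smul, Submodule.mkQ_apply, ← Submodule.Quotient.mk_smul, Submodule.Quotient.mk_eq_zero,
      smul_eq_mul, mul_comm, ← smul_eq_mul]
    exact Submodule.smul_mem _ _ (Submodule.mem_span_singleton_self μ)
  exact CharIdealLambda.finrank_baseChange_quotient_span_smul_eq_add F μ hz r hr htors

/-- **K5 (the slack-corrected zeta quotient is an invariant of the valued line).** For a finitely generated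
`Λ`-module `H` with an injective `Λ`-linear functional `f : H → Λ` (the tree's `e ∘ 𝒸` once one value is nonzero,
K3) and two classes with values `f zᵢ = aᵢ · L`, `aᵢ ≠ 0`, `L ≠ 0`, whose zeta quotients are torsion:
`λ(H/Λz₁) + λ(Λ/(a₂)) = λ(H/Λz₂) + λ(Λ/(a₁))`, i.e. `λ(H/Λz) − λ(Λ/(a))` does not depend on the valued class.
Hence child B's `∀`-clause `(ii_λ): λ(𝐇¹/Λz) ≤ λ(X₀) + λ(Λ/(μt))` is ONE inequality on the invariant (constants `q`
are λ-null by K1), the slack is NECESSARY as soon as A admits a multiplier with `λ(μt) > 0`, and it is VOID on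
the constant-multiplier classes. [cite: Kato2004Asterisque, Thm. 12.4 (p. 221), Thm. 12.5 (1) (p. 222)]
[cite: Washington1997, §13.2] -/
theorem finrank_add_slack_eq_of_valued {H : Type u} [AddCommGroup H] [Module (PowerSeries A) H] [Module A H]
    [IsScalarTower A (PowerSeries A) H] [Module.Finite (PowerSeries A) H]
    (f : H →ₗ[PowerSeries A] PowerSeries A) (hf : Function.Injective f)
    {z₁ z₂ : H} {a₁ a₂ L : PowerSeries A} (ha₁ : a₁ ≠ 0) (ha₂ : a₂ ≠ 0) (hL : L ≠ 0)
    (h₁ : f z₁ = a₁ * L) (h₂ : f z₂ = a₂ * L)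
    (ht₁ : Module.IsTorsion (PowerSeries A) (H ⧸ Submodule.span (PowerSeries A) {z₁}))
    (ht₂ : Module.IsTorsion (PowerSeries A) (H ⧸ Submodule.span (PowerSeries A) {z₂})) :
    Module.finrank F (F ⊗[A] (H ⧸ Submodule.span (PowerSeries A) {z₁})) +
        Module.finrank F (F ⊗[A] (PowerSeries A ⧸ Ideal.span {a₂})) =
      Module.finrank F (F ⊗[A] (H ⧸ Submodule.span (PowerSeries A) {z₂})) +
        Module.finrank F (F ⊗[A] (PowerSeries A ⧸ Ideal.span {a₁})) := by
  have hz₁ : f z₁ ≠ 0 := by rw [h₁]; exact mul_ne_zero ha₁ hL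
  have hz₂ : f z₂ ≠ 0 := by rw [h₂]; exact mul_ne_zero ha₂ hL
  have hcomm : a₂ • z₁ = a₁ • z₂ := smul_eq_smul_of_apply_eq_mul f hf h₁ h₂
  have e₁ := CharIdealLambda.finrank_baseChange_quotient_span_smul_eq_add F z₁
    (smul_eq_zero_imp_of_apply_ne_zero f hz₁) a₂ ha₂ ht₁
  have e₂ := CharIdealLambda.finrank_baseChange_quotient_span_smul_eq_add F z₂
    (smul_eq_zero_imp_of_apply_ne_zero f hz₂) a₁ ha₁ ht₂
  rw [hcomm] at e₁
  omega

end Slack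

/-! ## §3 The values-level shift: why Λ-valued multipliers of every λ occur once one does -/

section Shift

variable {G : Type*} [CommGroup G] [Fintype G] {R : Type*} [CommRing R] {V : Type*} [AddCommGroup V] [Module R V]

/-- **K4 (Galois-sum shift).** `Σ_b ψ(b)⁻¹ • F(b·b₀) = ψ(b₀) • Σ_b ψ(b)⁻¹ • F(b)` for a character `ψ : G →* R`.
With `G = (ℤ/2^{m+2})ˣ`, `F(b) = τ_b • w`, `b₀ = 5 ↔ γ`: replacing the comparison datum `w` by `τ₅•w − w` (the
effect of `z ↦ (γ − 1)•z` on the (BK_ρ) side) multiplies the (VAL_ρ) left side by `ψ(5) − 1 = T(ψ(5) − 1)`, i.e.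
`μt ↦ T·μt`: child A's predicate is closed under this move, so its `∃` ranges over multipliers of every λ-invariant
as soon as it is inhabited — the reason B's `∀`-clause must carry the slack `λ(Λ/(μt))` (K5). [folklore] -/
theorem sum_inv_smul_shift (ψ : G →* R) (Fv : G → V) (b₀ : G) :
    ∑ b, ψ b⁻¹ • Fv (b * b₀) = ψ b₀ • ∑ b, ψ b⁻¹ • Fv b := by
  rw [Finset.smul_sum]
  refine Fintype.sum_equiv (Equiv.mulRight b₀) _ _ fun b => ?_
  rw [Equiv.coe_mulRight, smul_smul, ← map_mul, mul_inv_rev, ← mul_assoc, mul_inv_cancel, one_mul]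

/-- **K4′ (difference form).** `Σ_b ψ(b)⁻¹ • (F(b·b₀) − F(b)) = (ψ(b₀) − 1) • Σ_b ψ(b)⁻¹ • F(b)`. [folklore] -/
theorem sum_inv_smul_shift_sub (ψ : G →* R) (Fv : G → V) (b₀ : G) :
    ∑ b, ψ b⁻¹ • (Fv (b * b₀) - Fv b) = (ψ b₀ - 1) • ∑ b, ψ b⁻¹ • Fv b := by
  simp only [smul_sub, Finset.sum_sub_distrib, sum_inv_smul_shift ψ Fv b₀, sub_smul, one_smul]

end Shift

end Summit.BirchSwinnertonDyer.BirchSwinnertonDyer.Cruxes.ResidualThetaCountLowerPureAtTwo.SideaK1G25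

end
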